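import Mathlib
import Literature.Analysis.FunctionSpaces.TorusTrigPoly
import Literature.Analysis.FluidPDE.NSGalerkinFourier

/-!
# The explicit inviscid linear response in a balanced-digit shear frame — DEFINITIONS
(negative side of `TaylorCertificates.KolmogorovFloor`, crux stmt-AnomalousDissipation-15122, line `digit-frame-closure`)

Line lead `prover-line-stmt-AnomalousDissipation-15122-0` (2026-08-16). This file carries NO theorem of substance:
it fixes, once, the explicit objects every stub of the line speaks about.

* §1 the BALANCED-DIGIT FRAME of level `L`: `B = 2L+1`, `e_L = (1, B, B²)`, `ξ_L = (B, B³−1, −B²)`,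
  `n_L = ξ_L × e_L`; the far-field skeleton is the exact Euler shear `U_L(x) = sin(2π ξ_L·x) e_L`.
* §2 the data of ONE MODE LINE `k + ℤξ` (seven integers `a = k·e, c = k·n, s = k·ξ, K = k·k, X2 = ξ·ξ,
  e2 = e·e, n2 = n·n`) and the force components `(ve, vx, vn)` of `v = ĝ(k)` in the orthogonal integer triad
  `(e, ξ, n)`; the integer symbols `E_j = |k+jξ|² − |ξ|²`, `N_j = |k+jξ|²`, `T_j = ξ·(k+jξ)`, the sheet sums
  `G± = Σ_{odd 0<±j≤2J+1} 1/E_j`.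
* §3 the CLOSED-FORM, FINITELY SUPPORTED response sequences on the line, truncated at `|m| ≤ 2J+1` (odd `m` only):
  `y_m = Λ_m / E_m` (`Λ` = the two sheet constants `λ±`, `λ₋ − λ₊ = σ`), the parity-chain partial sums `P_m`,
  `x_m, z_m` recovered from `P_m, y_m` and solenoidality, the pressure symbol `q_m`, the coefficient vector
  `c_m = x_m e + y_m ξ + z_m n`, and the three residual components `Re_m, Rx_m, Rn_m` of
  `π a (c_{m−1} − c_{m+1}) + π X2 (y_{m−1}+y_{m+1}) e − δ_{m0} v − q_m (k + mξ)` in the triad.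
* §4 the lattice objects: the shear coefficients, the response coefficient function of a truncated force
  (sum over forced modes `k` and odd `m` of `[κ = k + mξ] c_m`), the Fourier side `𝓛` of
  `b ↦ (U·∇)b + (b·∇)U`, and the fields `shearField`, `responseField`.

Paper derivation (integer triad, no square roots): crux dir `Cruxes/KolmogorovFloor/NOTES.md` (14030 lead handoff),
`LACUNARY-FRAME-r2-5.md` §3, `Ideas/digit-frame-closure.md`; numerics `num/line_closed_form.py` (this seat:
equations exact off the two edge sites `m = ±(2J+2)` to 1e-13, conjugate symmetry to 1e-15).
-/

noncomputable section

set_option linter.dupNamespace false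

open Matrix Finset UnitAddTorus
open scoped BigOperators ComplexConjugate

namespace Summit.AnomalousDissipation.AnomalousDissipation.Theorems.KolmogorovFloor.Response

open Literature.Analysis.FunctionSpaces Literature.Analysis.FluidPDE

/-! ## §1 The balanced-digit frame -/

/-- The digit base `B = 2L + 1`. -/
def digitB (L : ℕ) : ℤ := 2 * L + 1

/-- The streamwise lattice vector `e_L = (1, B, B²)`. -/
def digitE (L : ℕ) : Fin 3 → ℤ := ![1, digitB L, digitB L ^ 2]

/-- The shear wave vector `ξ_L = (B, B³ − 1, −B²)` (`ξ_L · e_L = 0`). -/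
def digitXi (L : ℕ) : Fin 3 → ℤ := ![digitB L, digitB L ^ 3 - 1, -(digitB L ^ 2)]

/-- Integer cross product on `ℤ³`. -/
def cross3 (a b : Fin 3 → ℤ) : Fin 3 → ℤ :=
  ![a 1 * b 2 - a 2 * b 1, a 2 * b 0 - a 0 * b 2, a 0 * b 1 - a 1 * b 0]

/-- The spanwise lattice vector `n_L = ξ_L × e_L`. -/
def digitN (L : ℕ) : Fin 3 → ℤ := cross3 (digitXi L) (digitE L)

/-! ## §2 Data of one mode line -/

/-- The seven integers of a mode line `k + ℤξ` in the frame `(ξ, e, n = ξ × e)`. -/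
structure LineData where
  /-- `a = k · e` -/
  a : ℤ
  /-- `c = k · n` -/
  c : ℤ
  /-- `s = k · ξ` -/
  s : ℤ
  /-- `K = k · k` -/
  K : ℤ
  /-- `X2 = ξ · ξ` -/
  X2 : ℤ
  /-- `e2 = e · e` -/
  e2 : ℤ
  /-- `n2 = n · n` -/
  n2 : ℤ

/-- The components of the forcing coefficient `v = ĝ(k)` in the triad: `v = ve•e + vx•ξ + vn•n`. -/
structure LineForce where
  /-- `ve = (e · v)/(e · e)` -/
  ve : ℂ
  /-- `vx = (ξ · v)/(ξ · ξ)` -/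
  vx : ℂ
  /-- `vn = (n · v)/(n · n)` -/
  vn : ℂ

/-- The line data of the lattice mode `k` in the frame `(ξ, e)`. -/
def lineData (k ξ e : Fin 3 → ℤ) : LineData where
  a := k ⬝ᵥ e
  c := k ⬝ᵥ cross3 ξ e
  s := k ⬝ᵥ ξ
  K := k ⬝ᵥ k
  X2 := ξ ⬝ᵥ ξ
  e2 := e ⬝ᵥ e
  n2 := cross3 ξ e ⬝ᵥ cross3 ξ e

/-- The bilinear (no conjugation) pairing of an integer vector with a complex vector: `Σᵢ wᵢ vᵢ`. -/
def ipair (w : Fin 3 → ℤ) (v : EuclideanSpace ℂ (Fin 3)) : ℂ := ∑ i, (w i : ℂ) * v i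

/-- The force components of `v` in the frame `(ξ, e)`. -/
def lineForce (ξ e : Fin 3 → ℤ) (v : EuclideanSpace ℂ (Fin 3)) : LineForce where
  ve := ipair e v / ((e ⬝ᵥ e : ℤ) : ℂ)
  vx := ipair ξ v / ((ξ ⬝ᵥ ξ : ℤ) : ℂ)
  vn := ipair (cross3 ξ e) v / ((cross3 ξ e ⬝ᵥ cross3 ξ e : ℤ) : ℂ)

namespace LineData

variable (d : LineData)

/-- `E_j = |k + jξ|² − |ξ|² = K + 2js + (j² − 1)X2`. -/
def E (j : ℤ) : ℤ := d.K + 2 * j * d.s + (j ^ 2 - 1) * d.X2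

/-- `N_j = |k + jξ|² = K + 2js + j²X2`. -/
def N (j : ℤ) : ℤ := d.K + 2 * j * d.s + j ^ 2 * d.X2

/-- `T_j = ξ · (k + jξ) = s + jX2`. -/
def T (j : ℤ) : ℤ := d.s + j * d.X2

/-- `D = c² e2 + a² n2` (the determinant recovering `x, z` from `P, y`). -/
def D : ℤ := d.c ^ 2 * d.e2 + d.a ^ 2 * d.n2

/-- `G₊ = Σ_{i=0}^{J} 1/E_{2i+1}`. -/
def Gp (J : ℕ) : ℝ := ∑ i ∈ range (J + 1), ((d.E (2 * (i : ℤ) + 1) : ℤ) : ℝ)⁻¹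

/-- `G₋ = Σ_{i=0}^{J} 1/E_{−(2i+1)}`. -/
def Gm (J : ℕ) : ℝ := ∑ i ∈ range (J + 1), ((d.E (-(2 * (i : ℤ) + 1)) : ℤ) : ℝ)⁻¹

/-- The sheet determinant `G = G₊ + G₋ = Σ_{odd |j| ≤ 2J+1} 1/E_j`. -/
def G (J : ℕ) : ℝ := d.Gp J + d.Gm J

end LineData

/-! ## §3 The closed-form response sequences on a line -/

section Line

variable (d : LineData) (F : LineForce) (J : ℕ)

/-- `σ = vx·K/(π a)` — the jump of `E·y` across `m = 0`. -/
def sigmaC : ℂ := F.vx * (d.K : ℂ) / ((Real.pi : ℂ) * (d.a : ℂ))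

/-- `ρ = (v · w)/(π a)` with `w = c e − a n`, i.e. `(c e2 ve − a n2 vn)/(π a)`. -/
def rhoC : ℂ := ((d.c : ℂ) * (d.e2 : ℂ) * F.ve - (d.a : ℂ) * (d.n2 : ℂ) * F.vn) / ((Real.pi : ℂ) * (d.a : ℂ))

/-- `ρ̃ = ρ a/(2 X2 c e2)`. -/
def rhoT : ℂ := rhoC d F * (d.a : ℂ) / (2 * (d.X2 : ℂ) * (d.c : ℂ) * (d.e2 : ℂ))

/-- The positive sheet constant `λ₊ = (ρ̃ − σ G₋)/G`. -/
def lamP : ℂ := (rhoT d F - sigmaC d F * (d.Gm J : ℂ)) / (d.G J : ℂ)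

/-- The negative sheet constant `λ₋ = (ρ̃ + σ G₊)/G` (so `λ₋ − λ₊ = σ`). -/
def lamM : ℂ := (rhoT d F + sigmaC d F * (d.Gp J : ℂ)) / (d.G J : ℂ)

/-- `Λ_m`: `λ₊` on odd `0 < m ≤ 2J+1`, `λ₋` on odd `−(2J+1) ≤ m < 0`, `0` otherwise. -/
def Lam (m : ℤ) : ℂ :=
  if m % 2 = 0 ∨ (2 * (J : ℤ) + 1 < |m|) then 0 else if 0 < m then lamP d F J else lamM d F J

/-- `y_m = Λ_m / E_m`. -/
def yC (m : ℤ) : ℂ := Lam d F J m / (d.E m : ℂ)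

/-- The increment of the `P`-chain at an even site `m'`:
`inc(m') = (X2 c e2/a)(y_{m'−1} + y_{m'+1}) − [m' = 0] ρ`. -/
def incC (m : ℤ) : ℂ :=
  ((d.X2 : ℂ) * (d.c : ℂ) * (d.e2 : ℂ) / (d.a : ℂ)) * (yC d F J (m - 1) + yC d F J (m + 1))
    - (if m = 0 then rhoC d F else 0)

/-- `P_m` (`= c_m · (c e − a n)`): `0` at even `m`; for odd `m > 0` minus the sum of the increments at the even
sites `2i ∈ (m, 2J+2]`; for odd `m < 0` the sum of the increments at the even sites `−2i ∈ [−2J−2, m)`. -/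
def PC (m : ℤ) : ℂ :=
  if m % 2 = 0 then 0
  else if 0 < m then -∑ i ∈ (range (J + 2)).filter (fun i : ℕ => m < 2 * (i : ℤ)), incC d F J (2 * (i : ℤ))
  else ∑ i ∈ (range (J + 2)).filter (fun i : ℕ => -m < 2 * (i : ℤ)), incC d F J (-(2 * (i : ℤ)))

/-- `x_m = (c P_m − a n2 T_m y_m)/D`. -/
def xC (m : ℤ) : ℂ :=
  ((d.c : ℂ) * PC d F J m - (d.a : ℂ) * (d.n2 : ℂ) * (d.T m : ℂ) * yC d F J m) / (d.D : ℂ)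

/-- `z_m = (−a P_m − c e2 T_m y_m)/D`. -/
def zC (m : ℤ) : ℂ :=
  (-((d.a : ℂ) * PC d F J m) - (d.c : ℂ) * (d.e2 : ℂ) * (d.T m : ℂ) * yC d F J m) / (d.D : ℂ)

/-- The pressure symbol `q_m = 2π a X2 (y_{m−1} + y_{m+1})/N_m`. -/
def qC (m : ℤ) : ℂ :=
  2 * (Real.pi : ℂ) * (d.a : ℂ) * (d.X2 : ℂ) * (yC d F J (m - 1) + yC d F J (m + 1)) / (d.N m : ℂ)

/-- `e`-component of the residual at site `m`:
`Re_m = π a (x_{m−1} − x_{m+1}) + π X2 (y_{m−1} + y_{m+1}) − [m=0] ve − q_m a/e2`. -/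
def ReC (m : ℤ) : ℂ :=
  (Real.pi : ℂ) * (d.a : ℂ) * (xC d F J (m - 1) - xC d F J (m + 1))
    + (Real.pi : ℂ) * (d.X2 : ℂ) * (yC d F J (m - 1) + yC d F J (m + 1))
    - (if m = 0 then F.ve else 0) - qC d F J m * (d.a : ℂ) / (d.e2 : ℂ)

/-- `ξ`-component of the residual at site `m`: `Rx_m = π a (y_{m−1} − y_{m+1}) − [m=0] vx − q_m T_m/X2`. -/
def RxC (m : ℤ) : ℂ :=
  (Real.pi : ℂ) * (d.a : ℂ) * (yC d F J (m - 1) - yC d F J (m + 1))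
    - (if m = 0 then F.vx else 0) - qC d F J m * (d.T m : ℂ) / (d.X2 : ℂ)

/-- `n`-component of the residual at site `m`: `Rn_m = π a (z_{m−1} − z_{m+1}) − [m=0] vn − q_m c/n2`. -/
def RnC (m : ℤ) : ℂ :=
  (Real.pi : ℂ) * (d.a : ℂ) * (zC d F J (m - 1) - zC d F J (m + 1))
    - (if m = 0 then F.vn else 0) - qC d F J m * (d.c : ℂ) / (d.n2 : ℂ)

end Line

/-- The odd window `{±(2i+1) : 0 ≤ i ≤ J}` = `{m odd : |m| ≤ 2J+1}` as a `Finset ℤ`. -/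
def oddWindow (J : ℕ) : Finset ℤ :=
  (range (J + 1)).image (fun i : ℕ => (2 * (i : ℤ) + 1)) ∪ (range (J + 1)).image (fun i : ℕ => -(2 * (i : ℤ) + 1))

/-! ## §4 Lattice objects -/

/-- The coefficient vector on the line of `k` at site `m`: `c_m = x_m e + y_m ξ + z_m n` (complex scalars on the
integer triad), for the force coefficient `v = ĝ(k)`. -/
def lineCoeff (ξ e k : Fin 3 → ℤ) (v : EuclideanSpace ℂ (Fin 3)) (J : ℕ) (m : ℤ) : EuclideanSpace ℂ (Fin 3) :=
  xC (lineData k ξ e) (lineForce ξ e v) J m • Torus.freqVec e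
    + yC (lineData k ξ e) (lineForce ξ e v) J m • Torus.freqVec ξ
    + zC (lineData k ξ e) (lineForce ξ e v) J m • Torus.freqVec (cross3 ξ e)

/-- The forced modes of a level-`L` truncation: the nonzero lattice points of the ball `k·k ≤ L²`. -/
def forcedModes (L : ℕ) : Finset (Fin 3 → ℤ) := (Torus.freqBall L).erase 0

/-- **The response coefficient function** of the force coefficients `g` (read on `forcedModes L`) in the frame
`(ξ, e)`, truncated at `|m| ≤ 2J+1`: `C(κ) = Σ_{k} Σ_{m odd} [κ = k + mξ] c^{(k)}_m`. -/
def respCoeff (L : ℕ) (ξ e : Fin 3 → ℤ) (g : (Fin 3 → ℤ) → EuclideanSpace ℂ (Fin 3)) (J : ℕ)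
    (κ : Fin 3 → ℤ) : EuclideanSpace ℂ (Fin 3) :=
  ∑ k ∈ forcedModes L, ∑ m ∈ oddWindow J, if κ = k + m • ξ then lineCoeff ξ e k (g k) J m else 0

/-- The Fourier coefficients of the integer-amplitude Kolmogorov shear `U(x) = sin(2π ξ·x) e`:
`Û(ξ) = −(i/2) e`, `Û(−ξ) = (i/2) e`. -/
def shearCoeff (ξ e : Fin 3 → ℤ) (κ : Fin 3 → ℤ) : EuclideanSpace ℂ (Fin 3) :=
  if κ = ξ then (-(Complex.I / 2)) • Torus.freqVec e
  else if κ = -ξ then (Complex.I / 2) • Torus.freqVec e else 0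

/-- The shear `U(x) = sin(2π ξ·x) e` as a real trigonometric polynomial on the ball of radius `R`. -/
def shearField (R : ℕ) (ξ e : Fin 3 → ℤ) : UnitAddTorus (Fin 3) → EuclideanSpace ℝ (Fin 3) :=
  Torus.realTrigPoly (Torus.freqBall R) (shearCoeff ξ e)

/-- **The Fourier side of the linearised transport** `b ↦ (U·∇)b + (b·∇)U` around `U = sin(2π ξ·x) e`, `ξ ⊥ e`:
`(𝓛C)(κ) = π (e·κ) [C(κ−ξ) − C(κ+ξ)] + π [ξ·C(κ−ξ) + ξ·C(κ+ξ)] e`. -/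
def linOp (ξ e : Fin 3 → ℤ) (C : (Fin 3 → ℤ) → EuclideanSpace ℂ (Fin 3)) (κ : Fin 3 → ℤ) :
    EuclideanSpace ℂ (Fin 3) :=
  ((Real.pi : ℂ) * ((κ ⬝ᵥ e : ℤ) : ℂ)) • (C (κ - ξ) - C (κ + ξ))
    + ((Real.pi : ℂ) * (ipair ξ (C (κ - ξ)) + ipair ξ (C (κ + ξ)))) • Torus.freqVec e

/-- The response field of the coefficient family `g` at level `L`, truncation `J`, synthesised on the ball of
radius `R` (any `R` exceeding the support works). -/
def responseField (R L : ℕ) (ξ e : Fin 3 → ℤ) (g : (Fin 3 → ℤ) → EuclideanSpace ℂ (Fin 3)) (J : ℕ) :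
    UnitAddTorus (Fin 3) → EuclideanSpace ℝ (Fin 3) :=
  Torus.realTrigPoly (Torus.freqBall R) (respCoeff L ξ e g J)

/-! ## §5 Sanity lemmas (definitional unfoldings used by every stub) -/

/-- `ξ_L · e_L = 0`. -/
theorem digitXi_dotProduct_digitE (L : ℕ) : digitXi L ⬝ᵥ digitE L = 0 := by
  simp [digitXi, digitE, dotProduct, Fin.sum_univ_three]
  ring

/-- `n = ξ × e` is orthogonal to `ξ`. -/
theorem cross3_dotProduct_left (a b : Fin 3 → ℤ) : cross3 a b ⬝ᵥ a = 0 := by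
  simp [cross3, dotProduct, Fin.sum_univ_three]
  ring

/-- `n = ξ × e` is orthogonal to `e`. -/
theorem cross3_dotProduct_right (a b : Fin 3 → ℤ) : cross3 a b ⬝ᵥ b = 0 := by
  simp [cross3, dotProduct, Fin.sum_univ_three]
  ring

/-- Lagrange's identity for the integer cross product when `a ⊥ b`: `|a × b|² = |a|²|b|²` needs `a·b = 0`;
in general `|a × b|² = |a|²|b|² − (a·b)²`. -/
theorem cross3_dotProduct_self (a b : Fin 3 → ℤ) :
    cross3 a b ⬝ᵥ cross3 a b = (a ⬝ᵥ a) * (b ⬝ᵥ b) - (a ⬝ᵥ b) ^ 2 := by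
  simp [cross3, dotProduct, Fin.sum_univ_three]
  ring

/-- Membership in the odd window: `m ∈ oddWindow J ↔ m` odd and `|m| ≤ 2J+1`. -/
theorem mem_oddWindow {J : ℕ} {m : ℤ} : m ∈ oddWindow J ↔ m % 2 = 1 ∧ |m| ≤ 2 * (J : ℤ) + 1 := by
  constructor
  · intro h
    simp only [oddWindow, mem_union, mem_image, mem_range] at h
    rcases h with ⟨i, hi, rfl⟩ | ⟨i, hi, rfl⟩
    · refine ⟨by omega, ?_⟩
      rw [abs_of_nonneg (by positivity)]; omega
    · refine ⟨by omega, ?_⟩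
      rw [abs_of_nonpos (by omega)]; omega
  · rintro ⟨hodd, habs⟩
    simp only [oddWindow, mem_union, mem_image, mem_range]
    rcases le_or_gt 0 m with hm | hm
    · left
      refine ⟨(m / 2).toNat, ?_, ?_⟩
      · have : m / 2 < J + 1 := by rw [abs_of_nonneg hm] at habs; omega
        omega
      · have h2 : ((m / 2).toNat : ℤ) = m / 2 := Int.toNat_of_nonneg (by omega)
        rw [h2]; omega
    · right
      refine ⟨((-m) / 2).toNat, ?_, ?_⟩
      · have : (-m) / 2 < J + 1 := by rw [abs_of_neg hm] at habs; omega
        omega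
      · have h2 : (((-m) / 2).toNat : ℤ) = (-m) / 2 := Int.toNat_of_nonneg (by omega)
        rw [h2]; omega

/-! ## §6 The response statement (conclusion of the line's Euler side; hypothesis of its bookkeeping) -/

open MeasureTheory in
open scoped InnerProductSpace in
/-- **The quantitative response in the digit frame.** Absolute `A, p` such that for every level `L ≥ 1`,
every truncation `J` and every smooth solenoidal mean-zero force `f` there are: the frame numbers
`X2 = ξ_L·ξ_L`, `e2 = e_L·e_L` (`1 ≤ X2, e2`, `X2 e2 ≤ 9B^{10}`, `|ξ_L| > L`), the exact Euler shear `U`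
(work-free up to the single coefficient `f̂(ξ_L)`: energy `e2/2`, enstrophy `2π² X2 e2`, slope `≤ √(X2 e2)`), and
a smooth solenoidal mean-zero response `b` with no modes in the `L`-ball whose energy / enstrophy / slope / sup
are bounded by `Cb·(1+log(2J+1))`, `Cb·(J+1)` (`Cb = A B^p Σ_{|k|≤L} ‖f̂(k)‖`, `B = 2L+1`), whose LINEARISED
steady-Euler defect `(U·∇)b + (b·∇)U − P_L f` pairs against every band-limited solenoidal multiplier of slope `≤ M`
to at most `Cb M/(J+1)²` (the two edge sites of each mode line) and whose self-advection pairs to at most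
`(Cb(1+log(2J+1)))² M`. The statement of the line's ASSEMBLY stub (an obligation of the line, proved by the lead
from the FRAME / DET / LINE-ALGEBRA / LINE-BOUNDS / DICTIONARY stubs; hypothesis of the CHEAP bookkeeping stub). -/
def ResponseStatement : Prop :=
  ∃ A p : ℕ, ∀ (L J : ℕ), 1 ≤ L →
    ∀ f : UnitAddTorus (Fin 3) → EuclideanSpace ℝ (Fin 3),
      Torus.IsSmooth f → Torus.IsDivFree f → Torus.HasZeroMean f →
      ∃ (U b : UnitAddTorus (Fin 3) → EuclideanSpace ℝ (Fin 3)) (X2 e2 Cb : ℝ),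
        X2 = ((digitXi L ⬝ᵥ digitXi L : ℤ) : ℝ) ∧ e2 = ((digitE L ⬝ᵥ digitE L : ℤ) : ℝ) ∧
        Cb = (A : ℝ) * (2 * (L : ℝ) + 1) ^ p *
          ∑ κ ∈ Torus.freqBall L, ‖mFourierCoeff (EuclideanSpace.complexify ∘ f) κ‖ ∧
        (1 ≤ X2 ∧ 1 ≤ e2 ∧ X2 * e2 ≤ 9 * (2 * (L : ℝ) + 1) ^ 10 ∧
          (L : ℝ) ^ 2 < Torus.freqNormSq (digitXi L)) ∧
        (Torus.IsSmooth U ∧ Torus.IsDivFree U ∧ Torus.HasZeroMean U ∧ (∀ x, Torus.convect U U x = 0) ∧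
          (∫ x, ‖U x‖ ^ 2) = e2 / 2 ∧ (Torus.eGradNormSq U).toReal = 2 * Real.pi ^ 2 * X2 * e2 ∧
          (∀ N : ℕ, ∑ κ ∈ Torus.freqBall N, Real.sqrt (Torus.freqNormSq κ) *
            ‖mFourierCoeff (EuclideanSpace.complexify ∘ U) κ‖ ≤ Real.sqrt (X2 * e2)) ∧
          |∫ x, ⟪U x, f x⟫_ℝ| ≤
            Real.sqrt e2 * ‖mFourierCoeff (EuclideanSpace.complexify ∘ f) (digitXi L)‖) ∧
        (Torus.IsSmooth b ∧ Torus.IsDivFree b ∧ Torus.HasZeroMean b ∧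
          (∫ x, ‖b x‖ ^ 2) ≤ (Cb * (1 + Real.log (2 * J + 1))) ^ 2 ∧
          (Torus.eGradNormSq b).toReal ≤ (Cb * ((J : ℝ) + 1)) ^ 2 ∧
          (∀ N : ℕ, ∑ κ ∈ Torus.freqBall N, Real.sqrt (Torus.freqNormSq κ) *
            ‖mFourierCoeff (EuclideanSpace.complexify ∘ b) κ‖ ≤ Cb * ((J : ℝ) + 1)) ∧
          (∀ κ, ‖mFourierCoeff (EuclideanSpace.complexify ∘ b) κ‖ ≤ Cb * (1 + Real.log (2 * J + 1))) ∧
          (∀ κ ∈ Torus.freqBall L, mFourierCoeff (EuclideanSpace.complexify ∘ b) κ = 0)) ∧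
        (∀ (N : ℕ) (W : UnitAddTorus (Fin 3) → EuclideanSpace ℝ (Fin 3)) (M : ℝ),
          Torus.IsSmooth W → Torus.IsDivFree W → Torus.HasZeroMean W →
          (∀ κ, (N : ℝ) ^ 2 < Torus.freqNormSq κ → mFourierCoeff (EuclideanSpace.complexify ∘ W) κ = 0) →
          (∀ κ, Real.sqrt (Torus.freqNormSq κ) * ‖mFourierCoeff (EuclideanSpace.complexify ∘ W) κ‖ ≤ M) →
          |∫ x, ⟪Torus.convect U b x + Torus.convect b U x - Torus.fourierTruncate L f x, W x⟫_ℝ| ≤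
              Cb / ((J : ℝ) + 1) ^ 2 * M ∧
          |∫ x, ⟪Torus.convect b b x, W x⟫_ℝ| ≤ (Cb * (1 + Real.log (2 * J + 1))) ^ 2 * M)

open MeasureTheory in
open scoped InnerProductSpace in
/-- **CHEAP approximate steady Euler states for every admissible force** — the ν-free Euler statement the crux
was reduced to by the standing disprover: VERBATIM the tree's
`Theorems.KolmogorovFloor.Negative.CheapSteadyEulerStates` (Negative/CheapStatesKill.lean; the two agree by
`Iff.rfl`). It is restated here, as an obligation of the line, only because the line's stubs must be
statable while that module is not served by the farm; the line's KILL stub `CheapStatesStatement → ¬ KolmogorovFloor`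
is the tree theorem `kolmogorovFloor_false_of_CheapSteadyEulerStates` the moment it is. For every smooth solenoidal
mean-zero `f` and every small `η`: a smooth solenoidal mean-zero state of enstrophy and energy `≤ η^{-11/10}`,
Wiener slope `≤ η^{-3/5}` on every ball, work `≤ η^{2/5}` and steady-Euler defect `≤ η·M` against every
band-limited solenoidal mean-zero multiplier of slope `≤ M`. -/
def CheapStatesStatement : Prop :=
  ∀ f : UnitAddTorus (Fin 3) → EuclideanSpace ℝ (Fin 3), Torus.IsSmooth f → Torus.IsDivFree f →
    Torus.HasZeroMean f →
    ∃ η₀ : ℝ, 0 < η₀ ∧ ∀ η : ℝ, 0 < η → η < η₀ →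
      ∃ a : UnitAddTorus (Fin 3) → EuclideanSpace ℝ (Fin 3),
        Torus.IsSmooth a ∧ Torus.IsDivFree a ∧ Torus.HasZeroMean a ∧
        (Torus.eGradNormSq a).toReal ≤ η ^ (-(11 / 10 : ℝ)) ∧ (∫ x, ‖a x‖ ^ 2) ≤ η ^ (-(11 / 10 : ℝ)) ∧
        (∀ N : ℕ, ∑ κ ∈ Torus.freqBall N, Real.sqrt (Torus.freqNormSq κ) *
          ‖mFourierCoeff (EuclideanSpace.complexify ∘ a) κ‖ ≤ η ^ (-(3 / 5 : ℝ))) ∧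
        |∫ x, ⟪a x, f x⟫_ℝ| ≤ η ^ (2 / 5 : ℝ) ∧
        ∀ (N : ℕ) (W : UnitAddTorus (Fin 3) → EuclideanSpace ℝ (Fin 3)) (M : ℝ),
          Torus.IsSmooth W → Torus.IsDivFree W → Torus.HasZeroMean W →
          (∀ κ, (N : ℝ) ^ 2 < Torus.freqNormSq κ → mFourierCoeff (EuclideanSpace.complexify ∘ W) κ = 0) →
          (∀ κ, Real.sqrt (Torus.freqNormSq κ) * ‖mFourierCoeff (EuclideanSpace.complexify ∘ W) κ‖ ≤ M) →
          |∫ x, ⟪Torus.convect a a x - f x, W x⟫_ℝ| ≤ η * M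

end Summit.AnomalousDissipation.AnomalousDissipation.Theorems.KolmogorovFloor.Response
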